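import Summits.CriticalPhenomena.SAWScalingLimit.Theses.SAWRestrictionRigidity
import Literature.Probability.RandomPlanarGeometry.ConformalMapRiemannProofs
import Literature.Probability.RandomPlanarGeometry.ConformalMapCaratheodoryProofs
import Literature.Probability.RandomPlanarGeometry.JordanDomainProofs
import Literature.Probability.RandomPlanarGeometry.DiscRectangles
import Literature.Probability.RandomPlanarGeometry.ConformalRestrictionProofs

/-!
# Stub `stub_discUniformization` of line `registered` (reshape v5, dichotomy + reference-disc cut), crux `Rigidity` (stmt-CriticalPhenomena-1368), route SAWRestrictionRigidity

Target: `Summits/CriticalPhenomena/SAWScalingLimit/Theorems/SAWRestrictionRigidityRigidityDiscUniformization.lean`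
(`--supports stmt-CriticalPhenomena-1368`).

**Disc uniformization.** If the laws `P D₀` of two-marked unit discs `D₀` (carrier
`Metric.ball 0 1`, any boundary parametrisation and marks) transport correctly,
`P D' = Φ_* P D₀`, along every `Φ : C(ℂ, ℂ)` complex differentiable on the open disc and
injective on the closed disc, then the law of EVERY Dobrushin domain `D₀` transports correctly
along every `Φ : C(ℂ, ℂ)` complex differentiable on `D₀` and injective on `closure D₀`.

Proof. The Riemann mapping theorem (`exists_conformalEquiv_ball_holds`) gives a conformal
equivalence `ψ : 𝔻 → D₀`; Carathéodory's theorem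
(`JordanDomain.exists_continuousOn_extension_holds`) extends it to a continuous bijection
`Ψ₀ : 𝔻̄ → D̄₀` mapping the circle onto `∂D₀`. The marks `a, b ∈ ∂D₀` have distinct preimages
`p, q` on the circle; the unit disc with boundary loop started at `p` (`JordanDomain.rotUnitDisc`)
and second mark at the parameter of `q` is a two-marked unit disc `D₁` with marks `p, q`. Extend
`Ψ₀` to a continuous plane map `Ψ` (Tietze). The hypothesis applied to `(D₁, D₀, Ψ)` gives
`P D₀ = Ψ_* P D₁`, and applied to `(D₁, D', Φ ∘ Ψ)` gives `P D' = (Φ ∘ Ψ)_* P D₁ = Φ_* Ψ_* P D₁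
= Φ_* P D₀` (functoriality of push-forwards, `Measure.map_map`, `CurveClass.map_map`).

References: L. V. Ahlfors, *Complex Analysis* (1979), Ch. 6 §1.1 Thm. 1 (Riemann mapping
theorem); Ch. Pommerenke, *Boundary Behaviour of Conformal Maps* (1992), Thm. 2.6
(Carathéodory); G. F. Lawler, *Conformally Invariant Processes in the Plane* (2005), §6.1
(transport of chordal laws by conformal maps).
-/

noncomputable section

namespace Summit.CriticalPhenomena.SAWScalingLimit.Cruxes.Rigidity.Dichotomy

open MeasureTheory Set Filter Topology Metric
open Literature.Probability.RandomPlanarGeometry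

/-- **Two-marked unit discs with prescribed marks.** For distinct points `p, q` of the unit circle
there is a Dobrushin domain with carrier the open unit disc and marked points `p`, `q`: the disc
with boundary loop `t ↦ e^{i(2πt + θ)}` started at `p = e^{iθ}` (`JordanDomain.rotUnitDisc θ`),
marked at the parameters `0` and `s ∈ (0, 1)` of `p` and `q`. [folklore] -/
private theorem exists_disc_pt_eq {p q : ℂ} (hp : p ∈ sphere (0 : ℂ) 1)
    (hq : q ∈ sphere (0 : ℂ) 1) (hpq : p ≠ q) :
    ∃ D₁ : DobrushinDomain, D₁.carrier = ball 0 1 ∧ D₁.pt 0 = p ∧ D₁.pt 1 = q := by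
  have hp' : p ∈ range (circleMap 0 1) := by rwa [range_circleMap, abs_one]
  obtain ⟨θ, rfl⟩ := hp'
  have hq' : q ∈ frontier (JordanDomain.rotUnitDisc θ).carrier := by
    rwa [JordanDomain.rotUnitDisc_carrier, frontier_ball (0 : ℂ) one_ne_zero]
  rw [JordanDomain.frontier_eq_image_Ico] at hq'
  obtain ⟨s, hs, hsq⟩ := hq'
  have h0 : (JordanDomain.rotUnitDisc θ).boundary 0 = circleMap 0 1 θ := by
    show circleMap 0 1 (2 * Real.pi * 0 + θ) = _
    rw [mul_zero, zero_add]
  have hs0 : 0 < s := by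
    refine lt_of_le_of_ne hs.1 fun h ↦ hpq ?_
    rw [← h0, ← hsq, ← h]
  refine ⟨{ toJordanDomain := JordanDomain.rotUnitDisc θ
            mark := ![0, s]
            strictMono_mark := ?_
            mark_mem := ?_ }, rfl, h0, hsq⟩
  · refine Fin.strictMono_iff_lt_succ.2 fun k ↦ ?_
    fin_cases k
    simpa using hs0
  · intro k
    fin_cases k
    · simp
    · simpa using hs

/-- stub B4 (bookkeeping, disc uniformization): if the laws of two-marked unit discs transport correctly along every `Φ : C(ℂ, ℂ)` conformal on the open disc and injective on the closed disc, then the law of EVERY Dobrushin domain `D₀` transports correctly along every `Φ : C(ℂ, ℂ)` conformal on `D₀` and injective on `closure D₀` (Riemann map + Carathéodory: `Ψ : 𝔻̄ → D̄₀` homeomorphism conformal inside, `exists_conformalEquiv_ball_holds`, `JordanDomain.exists_continuousOn_extension_holds`; mark the disc at `Ψ⁻¹ a`, `Ψ⁻¹ b` via `JordanDomain.rotUnitDisc`; extend `Ψ` continuously to `ℂ`; then `P D₀ = Ψ_* P 𝔻` and `P D' = (Φ ∘ Ψ)_* P 𝔻 = Φ_* P D₀`). [cite: PommerenkeBBCM1992,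 Thm. 2.6] -/
theorem stub_discUniformization : ∀ P : Literature.Probability.RandomPlanarGeometry.ChordalFamily, (∀ (D₀ D' : Literature.Probability.RandomPlanarGeometry.DobrushinDomain) (Φ : C(ℂ, ℂ)), D₀.carrier = Metric.ball 0 1 → DifferentiableOn ℂ Φ D₀.carrier → Set.InjOn Φ (closure D₀.carrier) → D'.carrier = Φ '' D₀.carrier → D'.pt 0 = Φ (D₀.pt 0) → D'.pt 1 = Φ (D₀.pt 1) → P D' = (P D₀).map (Literature.Probability.RandomPlanarGeometry.CurveClass.map Φ)) → ∀ (D₀ D' : Literature.Probability.RandomPlanarGeometry.DobrushinDomain) (Φ : C(ℂ, ℂ)), DifferentiableOn ℂ Φ D₀.carrier → Set.InjOn Φ (closure D₀.carrier) → D'.carrier = Φ '' D₀.carrier → D'.pt 0 = Φ (D₀.pt 0) → D'.pt 1 = Φ (D₀.pt 1) → P D' = (P D₀).map (Literature.Probability.RandomPlanarGeometry.CurveClass.map Φ) := by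
  intro P hdisc D₀ D' Φ hΦd hΦi hD' h0 h1
  -- (1) Riemann map of the disc onto `D₀`
  obtain ⟨φ⟩ := exists_conformalEquiv_ball_holds (U := D₀.carrier) D₀.isOpen
    D₀.toJordanDomain.isSimplyConnected_carrier D₀.toJordanDomain.carrier_ne_univ
  have ψ : ConformalEquiv (ball (0 : ℂ) 1) D₀.carrier := φ.symm
  -- (2) its Carathéodory extension to the closed disc
  obtain ⟨Ψ₀, hΨ₀c, hΨ₀e, hΨ₀bij, hΨ₀bij'⟩ :=
    JordanDomain.exists_continuousOn_extension_holds D₀.toJordanDomain ψ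
  -- (3) the preimages of the marks on the circle and the marked disc `D₁`
  obtain ⟨p, hp, hpa⟩ := hΨ₀bij'.surjOn (D₀.pt_mem_frontier 0)
  obtain ⟨q, hq, hqb⟩ := hΨ₀bij'.surjOn (D₀.pt_mem_frontier 1)
  have hpq : p ≠ q := by
    rintro rfl
    exact absurd (D₀.pt_injective (hpa.symm.trans hqb)) (by decide)
  obtain ⟨D₁, hD₁c, hD₁0, hD₁1⟩ := exists_disc_pt_eq hp hq hpq
  -- (4) a continuous extension of `Ψ₀` to the plane (Tietze)
  obtain ⟨Ψ, hΨ⟩ := ContinuousMap.exists_restrict_eq (Y := ℂ) isClosed_closedBall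
    ⟨(closedBall (0 : ℂ) 1).restrict Ψ₀, continuousOn_iff_continuous_restrict.1 hΨ₀c⟩
  have hΨeq : EqOn Ψ Ψ₀ (closedBall 0 1) := fun x hx ↦ by
    simpa using ContinuousMap.congr_fun hΨ ⟨x, hx⟩
  have hΨball : EqOn Ψ ψ (ball 0 1) := fun x hx ↦
    (hΨeq (ball_subset_closedBall hx)).trans (hΨ₀e hx)
  -- (5) `P D₀ = Ψ_* P D₁`
  have hcl : closure D₁.carrier = closedBall (0 : ℂ) 1 := by
    rw [hD₁c, closure_ball 0 one_ne_zero]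
  have hΨd : DifferentiableOn ℂ Ψ D₁.carrier := by
    rw [hD₁c]
    exact ψ.differentiableOn_coe.congr hΨball
  have hΨi : InjOn Ψ (closure D₁.carrier) := by
    rw [hcl]
    exact hΨeq.injOn_iff.2 hΨ₀bij.injOn
  have hΨim : Ψ '' D₁.carrier = D₀.carrier := by
    rw [hD₁c, hΨball.image_eq, ψ.bijOn.image_eq]
  have hΨ0 : Ψ (D₁.pt 0) = D₀.pt 0 := by rw [hD₁0, hΨeq (sphere_subset_closedBall hp), hpa]
  have hΨ1 : Ψ (D₁.pt 1) = D₀.pt 1 := by rw [hD₁1, hΨeq (sphere_subset_closedBall hq), hqb]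
  have h₁ : P D₀ = (P D₁).map (CurveClass.map Ψ) :=
    hdisc D₁ D₀ Ψ hD₁c hΨd hΨi hΨim.symm hΨ0.symm hΨ1.symm
  -- (6) `P D' = (Φ ∘ Ψ)_* P D₁`
  have hmaps : MapsTo Ψ D₁.carrier D₀.carrier := hΨim ▸ mapsTo_image Ψ D₁.carrier
  have hmaps' : MapsTo Ψ (closure D₁.carrier) (closure D₀.carrier) := by
    rw [hcl]
    exact hΨeq.mapsTo_iff.2 hΨ₀bij.mapsTo
  have hΦΨd : DifferentiableOn ℂ (Φ.comp Ψ) D₁.carrier := by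
    rw [ContinuousMap.coe_comp]
    exact hΦd.comp hΨd hmaps
  have hΦΨi : InjOn (Φ.comp Ψ) (closure D₁.carrier) := by
    rw [ContinuousMap.coe_comp]
    exact hΦi.comp hΨi hmaps'
  have hΦΨim : D'.carrier = (Φ.comp Ψ) '' D₁.carrier := by
    rw [ContinuousMap.coe_comp, image_comp, hΨim, hD']
  have hΦΨ0 : D'.pt 0 = (Φ.comp Ψ) (D₁.pt 0) := by
    rw [ContinuousMap.comp_apply, hΨ0, h0]
  have hΦΨ1 : D'.pt 1 = (Φ.comp Ψ) (D₁.pt 1) := by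
    rw [ContinuousMap.comp_apply, hΨ1, h1]
  have h₂ : P D' = (P D₁).map (CurveClass.map (Φ.comp Ψ)) :=
    hdisc D₁ D' (Φ.comp Ψ) hD₁c hΦΨd hΦΨi hΦΨim hΦΨ0 hΦΨ1
  -- (7) functoriality of push-forwards
  have hcomp : CurveClass.map (Φ.comp Ψ) = CurveClass.map Φ ∘ CurveClass.map Ψ :=
    funext fun c ↦ (CurveClass.map_map Ψ Φ c).symm
  rw [h₂, h₁, Measure.map_map (CurveClass.measurable_map Φ) (CurveClass.measurable_map Ψ), hcomp]

end Summit.CriticalPhenomena.SAWScalingLimit.Cruxes.Rigidity.Dichotomy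

end
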